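import Mathlib
import HarnessLib

/-!
# The all-or-nothing lemma at a TARGET: polynomial core (Sahi programme, prover prim-sahi-p2 gen 36)

Support file (`--supports stmt-CriticalPhenomena-4575`); no definitions, no named facts, no sorries; standard axioms.  Memo
`run/shared/lean/prim/prim-sahi/FROM-prim-sahi-p2-gen36-ALL-OR-NOTHING.md` §2(2f), `prim-sahi-p2/PROOF-E3.md` §46.

Companion of `allOrNothing_core` with the roles of root and target exchanged.  Root `s`, targets `i ≠ j`; at the target `i` the pairs `i–s`
(weight `a`) and `i–j` (weight `c`), `F_i` = every other pair at `i`, `H = G − i` arbitrary, `K = C_H(N′)` the `H`-cluster of the `F_i`-neighbours of `i`.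
Increasing `H`-events: `I_s = {s ∈ K}`, `I_j = {j ∈ K}`, `S_j = {s ↔_H j}` (with `I_s ∩ S_j ⊆ I_j`, `I_j ∩ S_j ⊆ I_s`); atoms `n₀ = P(none)`, `ν = P(S_j only)`, `x = P(I_s only)`,
`y = P(I_j only)`, `z = P(I_s I_j ¬S_j)`, `t = P(all)`.  With `P¹` = all of `F_i` open and `P⁰` = all of `F_i` closed:
`A¹ = P¹(s↔i) = a n₀ + (a+c−ac)ν + x + a y + z + t`, `B¹ = P¹(s↔j) = ac n₀ + ν + c x + a y + z + t`, `D¹ = P¹(both) = ac n₀ + (a+c−ac)ν + c x + a y + z + t`,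
`A⁰ = a + (1−a)c(ν+t)`, `B⁰ = (ν+t) + (1−ν−t)ac`, `D⁰ = ac + (a+c−2ac)(ν+t)`.
**`allOrNothing_target_core`**: the single Harris inequality `P(I_s)P(S_j) ≤ P(I_s ∩ S_j)`, i.e. `(x+z+t)(ν+t) ≤ t`, implies
`2(D¹ − D⁰) − A¹(B¹ − B⁰) − B¹(A¹ − A⁰) ≥ 0`, by the explicit identity `Δ = λ·slack + Σ_m r_m(a,c)·m`, `λ = (1−a)(1−c)(1−c+ac)`, all `r_m` manifestly
nonnegative products (no Bernstein certificate needed here).  The measure-level statement (for EVERY finite weighted graph: merging a TARGET with all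
its non-`s`, non-`j` neighbours satisfies the same `W`-comparison as merging the root, memo §2) is assembled from this core exactly as `allOrNothing_root`.
-/

noncomputable section

namespace Summit.CriticalPhenomena.PercolationContinuityZ3.Theorems

namespace IncStar

/-- **ALL-OR-NOTHING AT A TARGET, polynomial core.**  See the module docstring: `a, c ∈ [0,1]` the two kept pairs at the target, `(n₀, ν, x, y, z, t)` the
atom probabilities (`n₀` eliminated), `hIU` the Harris inequality `P(I_s)P(S_j) ≤ P(I_s ∩ S_j)`. [this work] -/
theorem allOrNothing_target_core (a c nu x y z t A1 B1 D1 A0 B0 D0 : ℝ)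
    (ha : 0 ≤ a) (ha' : a ≤ 1) (hc : 0 ≤ c) (hc' : c ≤ 1)
    (hnu : 0 ≤ nu) (hx : 0 ≤ x) (hy : 0 ≤ y) (hz : 0 ≤ z) (ht : 0 ≤ t) (hn0 : 0 ≤ 1 - nu - x - y - z - t)
    (hIU : (x + z + t) * (nu + t) ≤ t)
    (hA1 : A1 = a * (1 - nu - x - y - z - t) + (a + c - a * c) * nu + x + a * y + z + t)
    (hB1 : B1 = a * c * (1 - nu - x - y - z - t) + nu + c * x + a * y + z + t)
    (hD1 : D1 = a * c * (1 - nu - x - y - z - t) + (a + c - a * c) * nu + c * x + a * y + z + t)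
    (hA0 : A0 = a + (1 - a) * c * (nu + t)) (hB0 : B0 = (nu + t) + (1 - (nu + t)) * a * c) (hD0 : D0 = a * c + (a + c - 2 * a * c) * (nu + t)) :
    0 ≤ 2 * (D1 - D0) - A1 * (B1 - B0) - B1 * (A1 - A0) := by
  subst hA1 hB1 hD1 hA0 hB0 hD0
  have h1a : 0 ≤ 1 - a := sub_nonneg.2 ha'
  have h1c : 0 ≤ 1 - c := sub_nonneg.2 hc'
  have h2a : 0 ≤ 2 - a := by linarith
  have hac : 0 ≤ 1 - a * c := by nlinarith
  have hlam : 0 ≤ 1 - c + a * c := by nlinarith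
  have h2ac : 0 ≤ 2 - a - c * (1 - a) := by nlinarith
  have h2aa : 0 ≤ 2 - a + a * a := by nlinarith
  have hsl : 0 ≤ t - (x + z + t) * (nu + t) := sub_nonneg.2 hIU
  have key : 2 * ((a * c * (1 - nu - x - y - z - t) + (a + c - a * c) * nu + c * x + a * y + z + t)
        - (a * c + (a + c - 2 * a * c) * (nu + t)))
      - (a * (1 - nu - x - y - z - t) + (a + c - a * c) * nu + x + a * y + z + t)
        * ((a * c * (1 - nu - x - y - z - t) + nu + c * x + a * y + z + t) - ((nu + t) + (1 - (nu + t)) * a * c))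
      - (a * c * (1 - nu - x - y - z - t) + nu + c * x + a * y + z + t)
        * ((a * (1 - nu - x - y - z - t) + (a + c - a * c) * nu + x + a * y + z + t) - (a + (1 - a) * c * (nu + t)))
      = (1 - a) * (1 - c) * (1 - c + a * c) * (t - (x + z + t) * (nu + t))
        + 2 * c * (1 - a) * (1 - a) * ((1 - nu - x - y - z - t) * x)
        + a * (2 - a) * (1 - c) * ((1 - nu - x - y - z - t) * y)
        + ((1 - c) * (2 - a) + 2 * c * (1 - a) * (1 - a)) * ((1 - nu - x - y - z - t) * z)
        + (1 - a) * (1 - c) * ((1 - a * c) + c * (1 - a)) * ((1 - nu - x - y - z - t) * t)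
        + a * (1 - c) * (2 - a - c * (1 - a)) * (nu * y)
        + ((1 - c) * ((1 - a * c) + a * a * c) + (1 - a) * (1 - c) * (1 - c + a * c)) * (nu * z)
        + (1 - a) * (1 - c) * (nu * t)
        + ((1 - c) * a * a + 2 * c * (1 - a) * (1 - a)) * (x * y)
        + a * (1 - c) * (x * z)
        + (1 - a) * (1 - c) * (1 - c) * (x * t)
        + a * (2 - a) * (1 - c) * (y * y)
        + ((1 - c) * (2 - a + a * a) + 2 * c * (1 - a) * (1 - a)) * (y * z)
        + (1 - c) * ((1 - a) + a * a + c * (1 - a) * (1 - a)) * (y * t)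
        + a * (1 - c) * (z * z) + (1 - c) * (z * t) + (1 - a) * (1 - c) * (t * t) := by ring
  rw [key]
  positivity

end IncStar

end Summit.CriticalPhenomena.PercolationContinuityZ3.Theorems
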